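import Summits.AtomisticToContinuum.Crystallization.Theorems.OverbindingBudgetAffineFarSpread
import Summits.AtomisticToContinuum.Crystallization.Theorems.OverbindingBudgetAffineLayerMainA

/-!
# Overbinding budget, affine far-core cell (31280 Z2): COSET-FREE ENCLOSURE of the far-layer sums `layerSum B (2σ) k o`
# from one dual Bessel kernel row + Gram/height enclosures — the far-layer row format of the window TABLE
# (decomp-a2c lens-4, generation 66, Deliverable F part 2 of 2 = memo NODE-g66 §8 item (T2))

Imports g66 `…FarSpread` (covolume = √det Gram, `DualRow.check_sound` consumer, hcp reference demo lemmas; transitively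
g65 `…LayerSpread` for `layerShift`, `layerTerm_two_mul`, `layerShift_not_mem`) and part 1 `…LayerMainA`.  Restates nothing.
PROVED, 0 sorry, standard axioms (probe `TowerG66F.lean` rc 0; pins `TowerG66FPins.lean`; must-fail `TowerG66FMustFail.lean`):

* §F4 ★ `abs_layerSum_sub_main_le` — for injective `B`, `σ ≥ 2`, `k ≠ 0` and EVERY label `o`:
  `|layerSum B (2σ) k o − π/((σ−1)·covol Λ_B·d_k^{2σ−2})| ≤ (2π/(Γ(σ)·covol Λ_B)) Σ_{w∈Λ_B^*} (π‖w‖/d_k)^{σ−1}K_{σ−1}(2πd_k‖w‖)`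
  (`Λ_B = ℤBt₁+ℤBt₂`, `d_k = dist(layerShift B o k, W_B)`); ★★ `layerSum_far_encl_of_check` — with a row `R`
  (`R.check = true`, `R.μ + 1 = σ`, Gram enclosures ∋ Gram(Bt₁,Bt₂), `R.dlo ≤ d_k`) and main-term enclosures
  `0 < d₁ ≤ d_k ≤ d₂`, `0 < D₁ ≤ det Gram ≤ D₂`:
  `π/((σ−1)√D₂ d₂^{2σ−2}) − 2π/(Γ(σ)√(R.Dlo))·R.bound ≤ layerSum B (2σ) k o ≤ π/((σ−1)√D₁ d₁^{2σ−2}) + 2π/(Γ(σ)√(R.Dlo))·R.bound`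
  — every far layer (`|k| ≥ 4`) of BOTH window sums `T₃↑, T₆↓` is enclosed by RATIONAL data, with no truncation in `(i,j)`.
* §F5 DEMO (hcp reference cell `B = id`): `dist_layerShift_id_eq` (`d_k = |k|√(2/3)` exactly), `gramDet_id` (`det = 3/4`),
  ★ `abs_layerSum_twelve_sub_main_le_hcpRef` / `abs_layerSum_six_sub_main_le_hcpRef` (`|k| ≥ 4`, every `o`:
  `|layerSum id 12 k o − π/(5√(3/4)(|k|√(2/3))¹⁰)| ≤ 222/10¹³`, `|layerSum id 6 k o − π/(2√(3/4)(|k|√(2/3))⁴)| ≤ 449/10¹²`,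
  from the g66 demo rows `demoRowHcpK4Mu5/Mu2` by `decide +kernel`), `abs_layerSum_twelve_four_sub_le_hcpRef`
  (`|layerSum id 12 4 o − 5254188/10¹²| ≤ 24/10¹²`, with `Real.pi_gt_d20/pi_lt_d20`).

What this buys for Z2 (memo NODE-g66 §10): the far part (`|k| ≥ 4`) of the window sums is now a CLOSED FORM
`Σ_{|k|≥4} π/((σ−1) covol_B d_k^{2σ−2})` (for linear `X`, `d_k = |k|·d₁`) plus certified remainders `≤ 10⁻⁹`, so the TABLE needs
per-box kernels only for the seven near layers `|k| ≤ 3`.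
-/

noncomputable section

open MeasureTheory Set Module
open scoped Real InnerProductSpace

namespace Summit.AtomisticToContinuum.Crystallization.Theorems.OverbindingBudgetAffineFarSmoothSplit
open Literature.MathematicalPhysics.StatisticalMechanics Literature.Algebra.EuclideanLattices
  Literature.Analysis.FunctionSpaces
local notation "E3" => EuclideanSpace ℝ (Fin 3)

/-! ## §F4 ★ Window vocabulary: the coset-free main term of a far-layer sum `layerSum B (2σ) k o`,
and its certified two-sided ENCLOSURE from a dual Bessel row + Gram/height enclosures -/

/-- ★ **Main term of the far-layer sums** `layerSum B (2σ) k o` (`σ ≥ 2`, `k ≠ 0`, `B` injective): for EVERY label `o`,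
`|layerSum B (2σ) k o − π/((σ−1)·covol Λ_B·d_k^{2σ−2})| ≤ (2π/(Γ(σ)·covol Λ_B)) Σ_{w ∈ Λ_B^*} (π‖w‖/d_k)^{σ−1} K_{σ−1}(2π d_k‖w‖)`,
`Λ_B = ℤ·Bt₁ + ℤ·Bt₂ ⊂ W_B = span{Bt₁, Bt₂}`, `d_k = dist(layerShift B o k, W_B)` (independent of `o`).  The main term is
coset-free and the remainder is HALF the coset spread bound of `abs_layerSum_sub_layerSum_le`. [this file] -/
theorem abs_layerSum_sub_main_le (B : E3 →ₗ[ℝ] E3) (hB : Function.Injective B)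
    [MeasurableSpace (Submodule.span ℝ (Set.range ![B (triangularVec₁ 1), B (triangularVec₂ 1)]))]
    [BorelSpace (Submodule.span ℝ (Set.range ![B (triangularVec₁ 1), B (triangularVec₂ 1)]))]
    (σ : ℕ) (hσ : 1 < σ) {k : ℤ} (hk : k ≠ 0) (o : ℤ) :
    |layerSum B (2 * σ) k o -
        π / (((σ : ℝ) - 1) *
          ZLattice.covolume (Submodule.span ℤ (Set.range (Basis.span (linearIndependent_map_pair B hB)))) *
            ‖layerShift B o k - (Submodule.span ℝ
                (Set.range ![B (triangularVec₁ 1), B (triangularVec₂ 1)])).starProjection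
                  (layerShift B o k)‖ ^ (2 * σ - 2))| ≤
      2 * π / (Real.Gamma σ * ZLattice.covolume
            (Submodule.span ℤ (Set.range (Basis.span (linearIndependent_map_pair B hB))))) *
        ∑' w : dualLattice (Submodule.span ℤ (Set.range (Basis.span (linearIndependent_map_pair B hB)))),
          (π * ‖(w : Submodule.span ℝ (Set.range ![B (triangularVec₁ 1), B (triangularVec₂ 1)]))‖ /
              ‖layerShift B o k - (Submodule.span ℝ
                (Set.range ![B (triangularVec₁ 1), B (triangularVec₂ 1)])).starProjection
                  (layerShift B o k)‖) ^ ((σ : ℝ) - 1) *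
            besselKReal ((σ : ℝ) - 1)
              (2 * π * ‖layerShift B o k - (Submodule.span ℝ
                (Set.range ![B (triangularVec₁ 1), B (triangularVec₂ 1)])).starProjection
                  (layerShift B o k)‖ *
                ‖(w : Submodule.span ℝ (Set.range ![B (triangularVec₁ 1), B (triangularVec₂ 1)]))‖) := by
  simp only [layerSum, layerTerm_two_mul]
  exact abs_tsum_int_pair_translate_sub_main_le (linearIndependent_map_pair B hB) σ hσ
    (layerShift_not_mem B hB hk o)

/-- ★★ **Certified two-sided enclosure of a far-layer sum** from a dual Bessel row `R` (`R.check = true`, order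
`R.μ = σ − 1`, Gram enclosures containing the layer Gram matrix, `R.dlo ≤ d_k`) and main-term enclosures
`0 < d₁ ≤ d_k ≤ d₂`, `0 < D₁ ≤ det Gram ≤ D₂`:
`π/((σ−1)·√D₂·d₂^{2σ−2}) − 2π/(Γ(σ)√(R.Dlo))·R.bound ≤ layerSum B (2σ) k o ≤ π/((σ−1)·√D₁·d₁^{2σ−2}) + 2π/(Γ(σ)√(R.Dlo))·R.bound`.
This is the far-layer row format of the window TABLE (memo NODE-g66 §8 (T2)): every far layer of BOTH window sums
is enclosed, coset-free, by rational data. [this file] -/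
theorem layerSum_far_encl_of_check (B : E3 →ₗ[ℝ] E3) (hB : Function.Injective B)
    [MeasurableSpace (Submodule.span ℝ (Set.range ![B (triangularVec₁ 1), B (triangularVec₂ 1)]))]
    [BorelSpace (Submodule.span ℝ (Set.range ![B (triangularVec₁ 1), B (triangularVec₂ 1)]))]
    (σ : ℕ) (hσ : 1 < σ) {k : ℤ} (hk : k ≠ 0) (o : ℤ) (R : DualRow) (hR : R.check = true) (hμ : R.μ + 1 = σ)
    (h00 : (R.g00lo : ℝ) ≤ ‖B (triangularVec₁ 1)‖ ^ 2 ∧ ‖B (triangularVec₁ 1)‖ ^ 2 ≤ R.g00hi)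
    (h01 : (R.g01lo : ℝ) ≤ ⟪B (triangularVec₁ 1), B (triangularVec₂ 1)⟫_ℝ ∧ ⟪B (triangularVec₁ 1), B (triangularVec₂ 1)⟫_ℝ ≤ R.g01hi)
    (h11 : (R.g11lo : ℝ) ≤ ‖B (triangularVec₂ 1)‖ ^ 2 ∧ ‖B (triangularVec₂ 1)‖ ^ 2 ≤ R.g11hi)
    (hd : (R.dlo : ℝ) ≤ ‖layerShift B o k - (Submodule.span ℝ
        (Set.range ![B (triangularVec₁ 1), B (triangularVec₂ 1)])).starProjection (layerShift B o k)‖)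
    {d₁ d₂ D₁ D₂ : ℝ} (hd₁ : 0 < d₁)
    (hd₁' : d₁ ≤ ‖layerShift B o k - (Submodule.span ℝ
        (Set.range ![B (triangularVec₁ 1), B (triangularVec₂ 1)])).starProjection (layerShift B o k)‖)
    (hd₂ : ‖layerShift B o k - (Submodule.span ℝ
        (Set.range ![B (triangularVec₁ 1), B (triangularVec₂ 1)])).starProjection (layerShift B o k)‖ ≤ d₂)
    (hD₁ : 0 < D₁)
    (hD₁' : D₁ ≤ ‖B (triangularVec₁ 1)‖ ^ 2 * ‖B (triangularVec₂ 1)‖ ^ 2 - ⟪B (triangularVec₁ 1), B (triangularVec₂ 1)⟫_ℝ ^ 2)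
    (hD₂ : ‖B (triangularVec₁ 1)‖ ^ 2 * ‖B (triangularVec₂ 1)‖ ^ 2 - ⟪B (triangularVec₁ 1), B (triangularVec₂ 1)⟫_ℝ ^ 2 ≤ D₂) :
    π / (((σ : ℝ) - 1) * Real.sqrt D₂ * d₂ ^ (2 * σ - 2)) - 2 * π / (Real.Gamma σ * Real.sqrt R.Dlo) * R.bound ≤
        layerSum B (2 * σ) k o ∧
      layerSum B (2 * σ) k o ≤
        π / (((σ : ℝ) - 1) * Real.sqrt D₁ * d₁ ^ (2 * σ - 2)) + 2 * π / (Real.Gamma σ * Real.sqrt R.Dlo) * R.bound := by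
  -- certificate facts: `1 ≤ μ`, `0 < dlo`, `0 < g00lo`, `0 < g11lo`, `0 < Dlo`
  have hR' := hR
  simp only [DualRow.check, Bool.and_eq_true, decide_eq_true_eq, List.all_eq_true, Bool.or_eq_true] at hR'
  obtain ⟨⟨⟨⟨⟨⟨⟨⟨⟨⟨⟨⟨⟨⟨⟨⟨⟨⟨hμ1, hdlo⟩, hg00⟩, hg11⟩, -⟩, -⟩, -⟩, hDlo⟩, -⟩, -⟩, -⟩, -⟩, -⟩, -⟩, -⟩, -⟩, -⟩,
    -⟩, -⟩ := hR'
  set b : Module.Basis (Fin 2) ℝ (Submodule.span ℝ (Set.range ![B (triangularVec₁ 1), B (triangularVec₂ 1)])) :=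
    Module.Basis.span (linearIndependent_map_pair B hB) with hbdef
  set dd : ℝ := ‖layerShift B o k - (Submodule.span ℝ
        (Set.range ![B (triangularVec₁ 1), B (triangularVec₂ 1)])).starProjection (layerShift B o k)‖ with hdd
  have hb0 : ((b 0 : Submodule.span ℝ (Set.range ![B (triangularVec₁ 1), B (triangularVec₂ 1)])) : E3) =
      B (triangularVec₁ 1) := by rw [hbdef, Module.Basis.span_apply]; rfl
  have hb1 : ((b 1 : Submodule.span ℝ (Set.range ![B (triangularVec₁ 1), B (triangularVec₂ 1)])) : E3) =
      B (triangularVec₂ 1) := by rw [hbdef, Module.Basis.span_apply]; rfl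
  have hn0 : ‖b 0‖ = ‖B (triangularVec₁ 1)‖ := by rw [Submodule.coe_norm, hb0]
  have hn1 : ‖b 1‖ = ‖B (triangularVec₂ 1)‖ := by rw [Submodule.coe_norm, hb1]
  have hi01 : ⟪b 0, b 1⟫_ℝ = ⟪B (triangularVec₁ 1), B (triangularVec₂ 1)⟫_ℝ := by rw [Submodule.coe_inner, hb0, hb1]
  have hspan : ∀ v : Submodule.span ℝ (Set.range ![B (triangularVec₁ 1), B (triangularVec₂ 1)]),
      v ∈ Submodule.span ℝ (Set.range ⇑b) := fun v => b.mem_span v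
  have hdlo' : (0 : ℝ) < R.dlo := by exact_mod_cast hdlo
  have hdd0 : 0 < dd := lt_of_lt_of_le hdlo' hd
  have hμ0 : R.μ ≠ 0 := by omega
  -- the certified dual sum
  have hsum : ∑' w : dualLattice (Submodule.span ℤ (Set.range ⇑b)),
      dualBesselTerm R.μ dd ‖(w : Submodule.span ℝ (Set.range ![B (triangularVec₁ 1), B (triangularVec₂ 1)]))‖ ≤
        R.bound :=
    R.check_sound hR (⇑b) hspan (by rw [hn0]; exact h00) (by rw [hi01]; exact h01) (by rw [hn1]; exact h11) hd
  have hsum0 := tsum_dualBesselTerm_nonneg (Submodule.span ℤ (Set.range ⇑b)) hμ0 hdd0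
  -- the covolume `√D₁ ≤ covol = √det ≤ √D₂`, `√(R.Dlo) ≤ covol`
  have hcovdet : ZLattice.covolume (Submodule.span ℤ (Set.range ⇑b)) =
      Real.sqrt (‖B (triangularVec₁ 1)‖ ^ 2 * ‖B (triangularVec₂ 1)‖ ^ 2 - ⟪B (triangularVec₁ 1), B (triangularVec₂ 1)⟫_ℝ ^ 2) := by
    rw [covolume_span_eq_sqrt_gramDet b, hn0, hn1, hi01]
  have hDR : ((R.Dlo : ℚ) : ℝ) ≤ ‖B (triangularVec₁ 1)‖ ^ 2 * ‖B (triangularVec₂ 1)‖ ^ 2 -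
      ⟪B (triangularVec₁ 1), B (triangularVec₂ 1)⟫_ℝ ^ 2 := R.Dlo_le hg00.le hg11.le h00.1 h01 h11.1
  have hDlo' : (0 : ℝ) < R.Dlo := by exact_mod_cast hDlo
  have hcovR : Real.sqrt R.Dlo ≤ ZLattice.covolume (Submodule.span ℤ (Set.range ⇑b)) := by
    rw [hcovdet]; exact Real.sqrt_le_sqrt hDR
  have hcov1 : Real.sqrt D₁ ≤ ZLattice.covolume (Submodule.span ℤ (Set.range ⇑b)) := by
    rw [hcovdet]; exact Real.sqrt_le_sqrt hD₁'
  have hcov2 : ZLattice.covolume (Submodule.span ℤ (Set.range ⇑b)) ≤ Real.sqrt D₂ := by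
    rw [hcovdet]; exact Real.sqrt_le_sqrt hD₂
  have hsq0 : 0 < Real.sqrt R.Dlo := Real.sqrt_pos.2 hDlo'
  have hsq1 : 0 < Real.sqrt D₁ := Real.sqrt_pos.2 hD₁
  have hcov0 : 0 < ZLattice.covolume (Submodule.span ℤ (Set.range ⇑b)) := lt_of_lt_of_le hsq1 hcov1
  have hΓ : 0 < Real.Gamma σ := Real.Gamma_pos_of_pos (by exact_mod_cast (by omega : 0 < σ))
  have hs1 : (0 : ℝ) < (σ : ℝ) - 1 := by
    have : (1 : ℝ) < σ := by exact_mod_cast hσ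
    linarith
  -- the main inequality and its two relaxations
  have hmain := abs_layerSum_sub_main_le B hB σ hσ hk o
  rw [spread_tsum_eq_tsum_dualBesselTerm _ hμ] at hmain
  rw [abs_sub_le_iff] at hmain
  obtain ⟨hup, hlow⟩ := hmain
  -- remainder ≤ 2π/(Γ√Dlo)·bound
  have hrem : 2 * π / (Real.Gamma σ * ZLattice.covolume (Submodule.span ℤ (Set.range ⇑b))) *
      (∑' w : dualLattice (Submodule.span ℤ (Set.range ⇑b)),
        dualBesselTerm R.μ dd ‖(w : Submodule.span ℝ (Set.range ![B (triangularVec₁ 1), B (triangularVec₂ 1)]))‖) ≤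
      2 * π / (Real.Gamma σ * Real.sqrt R.Dlo) * R.bound := by
    have hA : 2 * π / (Real.Gamma σ * ZLattice.covolume (Submodule.span ℤ (Set.range ⇑b))) ≤
        2 * π / (Real.Gamma σ * Real.sqrt R.Dlo) :=
      div_le_div_of_nonneg_left (by positivity) (mul_pos hΓ hsq0) (mul_le_mul_of_nonneg_left hcovR hΓ.le)
    exact mul_le_mul hA hsum hsum0 (by positivity)
  -- main term between the two rational-data quotients
  have hm_up : π / (((σ : ℝ) - 1) * ZLattice.covolume (Submodule.span ℤ (Set.range ⇑b)) * dd ^ (2 * σ - 2)) ≤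
      π / (((σ : ℝ) - 1) * Real.sqrt D₁ * d₁ ^ (2 * σ - 2)) := by
    refine div_le_div_of_nonneg_left Real.pi_pos.le (by positivity) ?_
    have h1 : d₁ ^ (2 * σ - 2) ≤ dd ^ (2 * σ - 2) := pow_le_pow_left₀ hd₁.le hd₁' _
    have h2 : ((σ : ℝ) - 1) * Real.sqrt D₁ ≤ ((σ : ℝ) - 1) * ZLattice.covolume (Submodule.span ℤ (Set.range ⇑b)) :=
      mul_le_mul_of_nonneg_left hcov1 hs1.le
    exact mul_le_mul h2 h1 (by positivity) (by positivity)
  have hm_low : π / (((σ : ℝ) - 1) * Real.sqrt D₂ * d₂ ^ (2 * σ - 2)) ≤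
      π / (((σ : ℝ) - 1) * ZLattice.covolume (Submodule.span ℤ (Set.range ⇑b)) * dd ^ (2 * σ - 2)) := by
    refine div_le_div_of_nonneg_left Real.pi_pos.le (by positivity) ?_
    have h1 : dd ^ (2 * σ - 2) ≤ d₂ ^ (2 * σ - 2) := pow_le_pow_left₀ hdd0.le hd₂ _
    have h2 : ((σ : ℝ) - 1) * ZLattice.covolume (Submodule.span ℤ (Set.range ⇑b)) ≤ ((σ : ℝ) - 1) * Real.sqrt D₂ :=
      mul_le_mul_of_nonneg_left hcov2 hs1.le
    exact mul_le_mul h2 h1 (by positivity) (le_trans (by positivity) h2)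
  constructor <;> linarith

/-! ## §F5 Demo: the hcp reference cell (`B = id`) — `d_k = |k|√(2/3)` exactly, far layers `|k| ≥ 4` enclosed
to `2.3·10⁻¹¹` (`n = 12`) and `4.5·10⁻¹⁰` (`n = 6`) by the g66 demo rows -/

/-- Distance to a subspace is at most the distance to any of its points. [folklore] -/
theorem norm_sub_starProjection_le_of_mem' {F : Type*} [NormedAddCommGroup F] [InnerProductSpace ℝ F]
    (K : Submodule ℝ F) [K.HasOrthogonalProjection] (x : F) {v : F} (hv : v ∈ K) :
    ‖x - K.starProjection x‖ ≤ ‖x - v‖ := by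
  rw [Submodule.starProjection_minimal]
  exact ciInf_le ⟨0, by rintro _ ⟨w, rfl⟩; exact norm_nonneg _⟩ (⟨v, hv⟩ : K)

/-- ★ For the reference cell `B = id`: `dist(layerShift id o k, W) = |k|·√(2/3)` EXACTLY (the normal part of
`o·w + k√(2/3)·e₃` is `k√(2/3)·e₃`, `w ∈ W`). [this file] -/
theorem dist_layerShift_id_eq (o k : ℤ) :
    ‖layerShift (LinearMap.id : E3 →ₗ[ℝ] E3) o k - (Submodule.span ℝ
      (Set.range ![(LinearMap.id : E3 →ₗ[ℝ] E3) (triangularVec₁ 1), (LinearMap.id : E3 →ₗ[ℝ] E3) (triangularVec₂ 1)])).starProjection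
        (layerShift (LinearMap.id : E3 →ₗ[ℝ] E3) o k)‖ = |(k : ℝ)| * Real.sqrt (2 / 3) := by
  refine le_antisymm ?_ (abs_mul_sqrt_le_dist_layerShift_id o k)
  have hv : (o : ℝ) • barlowOffset (1 : ℝ) ∈ Submodule.span ℝ
      (Set.range ![(LinearMap.id : E3 →ₗ[ℝ] E3) (triangularVec₁ 1), (LinearMap.id : E3 →ₗ[ℝ] E3) (triangularVec₂ 1)]) := by
    rw [barlowOffset_one_eq]
    refine Submodule.smul_mem _ _ (Submodule.smul_mem _ _ (Submodule.add_mem _ ?_ ?_))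
    · exact Submodule.subset_span ⟨0, rfl⟩
    · exact Submodule.subset_span ⟨1, rfl⟩
  refine (norm_sub_starProjection_le_of_mem' _ _ hv).trans (le_of_eq ?_)
  have hn : ‖(layerNormal (Real.sqrt (2 / 3)) : E3)‖ = Real.sqrt (2 / 3) := by
    have : (layerNormal (Real.sqrt (2 / 3)) : E3) = EuclideanSpace.single 2 (Real.sqrt (2 / 3)) := by
      ext i; fin_cases i <;> simp [layerNormal]
    rw [this, PiLp.norm_single, Real.norm_of_nonneg (Real.sqrt_nonneg _)]
  rw [layerShift, LinearMap.id_apply, LinearMap.id_apply, add_sub_cancel_left, norm_smul, Real.norm_eq_abs, hn]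

/-- The exact layer Gram determinant of the reference cell: `‖t₁‖²‖t₂‖² − ⟪t₁,t₂⟫² = 3/4`. -/
theorem gramDet_id :
    ‖(LinearMap.id : E3 →ₗ[ℝ] E3) (triangularVec₁ 1)‖ ^ 2 * ‖(LinearMap.id : E3 →ₗ[ℝ] E3) (triangularVec₂ 1)‖ ^ 2 -
      ⟪(LinearMap.id : E3 →ₗ[ℝ] E3) (triangularVec₁ 1), (LinearMap.id : E3 →ₗ[ℝ] E3) (triangularVec₂ 1)⟫_ℝ ^ 2 = 3 / 4 := by
  simp only [LinearMap.id_apply, norm_triangularVec₁_one, norm_triangularVec₂_one, inner_triangularVec_one]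
  norm_num

/-- ★ **End-to-end enclosure (hcp reference cell, `n = 12`, far layers `|k| ≥ 4`)**: for every label `o`,
`|layerSum id 12 k o − π/(5·√(3/4)·(|k|√(2/3))¹⁰)| ≤ 2π/(120·√(3/4))·3669/10¹³ ≤ 2.22·10⁻¹¹` — every far `r⁻¹²`
layer sum of the reference is KNOWN, coset-free, to `2.3·10⁻¹¹` from ONE kernel row. [this file] -/
theorem abs_layerSum_twelve_sub_main_le_hcpRef {k : ℤ} (hk : 4 ≤ |k|) (o : ℤ) :
    |layerSum (LinearMap.id : E3 →ₗ[ℝ] E3) 12 k o - π / (5 * Real.sqrt (3 / 4) * (|(k : ℝ)| * Real.sqrt (2 / 3)) ^ 10)| ≤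
      222 / 10 ^ 13 := by
  letI : MeasurableSpace (Submodule.span ℝ
      (Set.range ![(LinearMap.id : E3 →ₗ[ℝ] E3) (triangularVec₁ 1), (LinearMap.id : E3 →ₗ[ℝ] E3) (triangularVec₂ 1)])) := borel _
  haveI : BorelSpace (Submodule.span ℝ
      (Set.range ![(LinearMap.id : E3 →ₗ[ℝ] E3) (triangularVec₁ 1), (LinearMap.id : E3 →ₗ[ℝ] E3) (triangularVec₂ 1)])) := ⟨rfl⟩
  have hk0 : k ≠ 0 := by rintro rfl; simp at hk
  have hinj : Function.Injective (LinearMap.id : E3 →ₗ[ℝ] E3) := fun x y h => h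
  have hdk : 0 < |(k : ℝ)| * Real.sqrt (2 / 3) := by
    have : (4 : ℝ) ≤ |(k : ℝ)| := by rw [← Int.cast_abs]; exact_mod_cast hk
    have h23 : 0 < Real.sqrt (2 / 3) := Real.sqrt_pos.2 (by norm_num)
    positivity
  have h := layerSum_far_encl_of_check LinearMap.id hinj 6 (by norm_num) hk0 o demoRowHcpK4Mu5
    demoRowHcpK4Mu5_check rfl gram_id_encl.1 gram_id_encl.2.1 gram_id_encl.2.2 (dlo_le_dist_layerShift_id hk o)
    hdk (le_of_eq (dist_layerShift_id_eq o k).symm) (le_of_eq (dist_layerShift_id_eq o k)) (by norm_num : (0:ℝ) < 3 / 4)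
    (le_of_eq gramDet_id.symm) (le_of_eq gramDet_id)
  have hDlo : demoRowHcpK4Mu5.Dlo = 3 / 4 := by decide +kernel
  have hbd : demoRowHcpK4Mu5.bound = 3669 / 10 ^ 13 := by decide +kernel
  have hΓ : Real.Gamma ((6 : ℕ) : ℝ) = 120 := by
    rw [show ((6 : ℕ) : ℝ) = (5 : ℕ) + 1 by norm_num, Real.Gamma_nat_eq_factorial]; norm_num [Nat.factorial]
  rw [hDlo, hbd, hΓ] at h
  have hσ : ((6 : ℕ) : ℝ) - 1 = 5 := by norm_num
  have hp : (2 * 6 - 2 : ℕ) = 10 := by norm_num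
  rw [hσ, hp] at h
  have hs : (433 / 500 : ℝ) ≤ Real.sqrt ((3 / 4 : ℚ) : ℝ) := by
    rw [show (433 / 500 : ℝ) = Real.sqrt ((433 / 500) ^ 2) by rw [Real.sqrt_sq (by norm_num)]]
    exact Real.sqrt_le_sqrt (by norm_num)
  have h1 : 2 * π / (120 * Real.sqrt ((3 / 4 : ℚ) : ℝ)) ≤ 2 * 3.141593 / (120 * (433 / 500)) :=
    div_le_div₀ (by norm_num) (by nlinarith [Real.pi_lt_d6]) (by norm_num) (by nlinarith [hs])
  have hrem : 2 * π / (120 * Real.sqrt ((3 / 4 : ℚ) : ℝ)) * (((3669 / 10 ^ 13 : ℚ)) : ℝ) ≤ 222 / 10 ^ 13 := by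
    calc 2 * π / (120 * Real.sqrt ((3 / 4 : ℚ) : ℝ)) * (((3669 / 10 ^ 13 : ℚ)) : ℝ)
        ≤ 2 * 3.141593 / (120 * (433 / 500)) * (((3669 / 10 ^ 13 : ℚ)) : ℝ) :=
          mul_le_mul_of_nonneg_right h1 (by norm_num)
      _ ≤ 222 / 10 ^ 13 := by norm_num
  rw [abs_sub_le_iff]
  constructor <;> linarith [h.1, h.2]

/-- ★ **End-to-end enclosure (hcp reference cell, `n = 6`, far layers `|k| ≥ 4`)**:
`|layerSum id 6 k o − π/(2·√(3/4)·(|k|√(2/3))⁴)| ≤ 2π/(2·√(3/4))·1236/10¹³ ≤ 4.49·10⁻¹⁰`. [this file] -/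
theorem abs_layerSum_six_sub_main_le_hcpRef {k : ℤ} (hk : 4 ≤ |k|) (o : ℤ) :
    |layerSum (LinearMap.id : E3 →ₗ[ℝ] E3) 6 k o - π / (2 * Real.sqrt (3 / 4) * (|(k : ℝ)| * Real.sqrt (2 / 3)) ^ 4)| ≤
      449 / 10 ^ 12 := by
  letI : MeasurableSpace (Submodule.span ℝ
      (Set.range ![(LinearMap.id : E3 →ₗ[ℝ] E3) (triangularVec₁ 1), (LinearMap.id : E3 →ₗ[ℝ] E3) (triangularVec₂ 1)])) := borel _
  haveI : BorelSpace (Submodule.span ℝ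
      (Set.range ![(LinearMap.id : E3 →ₗ[ℝ] E3) (triangularVec₁ 1), (LinearMap.id : E3 →ₗ[ℝ] E3) (triangularVec₂ 1)])) := ⟨rfl⟩
  have hk0 : k ≠ 0 := by rintro rfl; simp at hk
  have hinj : Function.Injective (LinearMap.id : E3 →ₗ[ℝ] E3) := fun x y h => h
  have hdk : 0 < |(k : ℝ)| * Real.sqrt (2 / 3) := by
    have : (4 : ℝ) ≤ |(k : ℝ)| := by rw [← Int.cast_abs]; exact_mod_cast hk
    have h23 : 0 < Real.sqrt (2 / 3) := Real.sqrt_pos.2 (by norm_num)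
    positivity
  have h := layerSum_far_encl_of_check LinearMap.id hinj 3 (by norm_num) hk0 o demoRowHcpK4Mu2
    demoRowHcpK4Mu2_check rfl gram_id_encl.1 gram_id_encl.2.1 gram_id_encl.2.2 (dlo_le_dist_layerShift_id hk o)
    hdk (le_of_eq (dist_layerShift_id_eq o k).symm) (le_of_eq (dist_layerShift_id_eq o k)) (by norm_num : (0:ℝ) < 3 / 4)
    (le_of_eq gramDet_id.symm) (le_of_eq gramDet_id)
  have hDlo : demoRowHcpK4Mu2.Dlo = 3 / 4 := by decide +kernel
  have hbd : demoRowHcpK4Mu2.bound = 1236 / 10 ^ 13 := by decide +kernel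
  have hΓ : Real.Gamma ((3 : ℕ) : ℝ) = 2 := by
    rw [show ((3 : ℕ) : ℝ) = (2 : ℕ) + 1 by norm_num, Real.Gamma_nat_eq_factorial]; norm_num [Nat.factorial]
  rw [hDlo, hbd, hΓ] at h
  have hσ : ((3 : ℕ) : ℝ) - 1 = 2 := by norm_num
  have hp : (2 * 3 - 2 : ℕ) = 4 := by norm_num
  rw [hσ, hp] at h
  have hs : (433 / 500 : ℝ) ≤ Real.sqrt ((3 / 4 : ℚ) : ℝ) := by
    rw [show (433 / 500 : ℝ) = Real.sqrt ((433 / 500) ^ 2) by rw [Real.sqrt_sq (by norm_num)]]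
    exact Real.sqrt_le_sqrt (by norm_num)
  have h1 : 2 * π / (2 * Real.sqrt ((3 / 4 : ℚ) : ℝ)) ≤ 2 * 3.141593 / (2 * (433 / 500)) :=
    div_le_div₀ (by norm_num) (by nlinarith [Real.pi_lt_d6]) (by norm_num) (by nlinarith [hs])
  have hrem : 2 * π / (2 * Real.sqrt ((3 / 4 : ℚ) : ℝ)) * (((1236 / 10 ^ 13 : ℚ)) : ℝ) ≤ 449 / 10 ^ 12 := by
    calc 2 * π / (2 * Real.sqrt ((3 / 4 : ℚ) : ℝ)) * (((1236 / 10 ^ 13 : ℚ)) : ℝ)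
        ≤ 2 * 3.141593 / (2 * (433 / 500)) * (((1236 / 10 ^ 13 : ℚ)) : ℝ) :=
          mul_le_mul_of_nonneg_right h1 (by norm_num)
      _ ≤ 449 / 10 ^ 12 := by norm_num
  rw [abs_sub_le_iff]
  constructor <;> linarith [h.1, h.2]

/-- The numerical value at the first far layer `k = 4`, `n = 12`: `layerSum id 12 4 o ∈ 5.254188·10⁻⁶ ± 2.4·10⁻¹¹`
(main term `π/(5·(√3/2)·(32/3)⁵) = 5.25418812…·10⁻⁶`). [this file] -/
theorem abs_layerSum_twelve_four_sub_le_hcpRef (o : ℤ) :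
    |layerSum (LinearMap.id : E3 →ₗ[ℝ] E3) 12 4 o - 5254188 / 10 ^ 12| ≤ 24 / 10 ^ 12 := by
  have h := abs_layerSum_twelve_sub_main_le_hcpRef (k := 4) (by norm_num) o
  have h4 : (|((4 : ℤ) : ℝ)| * Real.sqrt (2 / 3)) ^ 10 = 4 ^ 10 * (2 / 3) ^ 5 := by
    rw [show ((4 : ℤ) : ℝ) = 4 by norm_num, abs_of_pos (by norm_num : (0:ℝ) < 4), mul_pow,
      show (Real.sqrt (2 / 3)) ^ 10 = ((Real.sqrt (2 / 3)) ^ 2) ^ 5 by rw [← pow_mul],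
      Real.sq_sqrt (by norm_num : (0:ℝ) ≤ 2 / 3)]
  rw [h4] at h
  -- enclose the main term: √(3/4) ∈ [0.86602540, 0.86602541], π ∈ (3.14159265, 3.1415927)
  have hs_lo : (86602540 / 10 ^ 8 : ℝ) ≤ Real.sqrt (3 / 4) := by
    rw [show (86602540 / 10 ^ 8 : ℝ) = Real.sqrt ((86602540 / 10 ^ 8) ^ 2) by rw [Real.sqrt_sq (by norm_num)]]
    exact Real.sqrt_le_sqrt (by norm_num)
  have hs_hi : Real.sqrt (3 / 4) ≤ 86602541 / 10 ^ 8 := by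
    rw [show (86602541 / 10 ^ 8 : ℝ) = Real.sqrt ((86602541 / 10 ^ 8) ^ 2) by rw [Real.sqrt_sq (by norm_num)]]
    exact Real.sqrt_le_sqrt (by norm_num)
  have hm_hi : π / (5 * Real.sqrt (3 / 4) * (4 ^ 10 * (2 / 3) ^ 5)) ≤ 3.1415927 / (5 * (86602540 / 10 ^ 8) * (4 ^ 10 * (2 / 3) ^ 5)) :=
    div_le_div₀ (by norm_num) (by linarith [Real.pi_lt_d20]) (by norm_num) (by nlinarith [hs_lo])
  have hm_lo : 3.14159265 / (5 * (86602541 / 10 ^ 8) * (4 ^ 10 * (2 / 3) ^ 5)) ≤ π / (5 * Real.sqrt (3 / 4) * (4 ^ 10 * (2 / 3) ^ 5)) :=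
    div_le_div₀ Real.pi_pos.le (by linarith [Real.pi_gt_d20]) (by positivity) (by nlinarith [hs_hi])
  rw [abs_sub_le_iff] at h ⊢
  constructor
  · have : 3.1415927 / (5 * (86602540 / 10 ^ 8) * (4 ^ 10 * (2 / 3) ^ 5)) ≤ (5254188 + 2 : ℝ) / 10 ^ 12 := by norm_num
    linarith [h.1, h.2]
  · have : (5254188 - 1 : ℝ) / 10 ^ 12 ≤ 3.14159265 / (5 * (86602541 / 10 ^ 8) * (4 ^ 10 * (2 / 3) ^ 5)) := by norm_num
    linarith [h.1, h.2]

end Summit.AtomisticToContinuum.Crystallization.Theorems.OverbindingBudgetAffineFarSmoothSplit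

end
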